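import Summits.KontsevichZagierPeriods.KontsevichZagierPeriods.Theses.HurwitzMicroSectors
import Summits.KontsevichZagierPeriods.KontsevichZagierPeriods.Theorems.HurwitzMicroSectorsNormalFormPrinciplePiBoxTransfer
import Summits.KontsevichZagierPeriods.KontsevichZagierPeriods.Theorems.HurwitzMicroSectorsNormalFormPrincipleVariants2265

/-! TTRL-lite variant V2268 of stmt-KontsevichZagierPeriods-3869

Variant V2268 = `stub_boxRigidity` (the leaf `BoxRigidity` of `NormalFormPrinciple`: two BOX-RATIONAL
representations — domain the open unit box, integrand `p/q` over `ℚ`, `q ≠ 0` on the box — with equal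
values are KZ-equivalent) under the move `fix_nat:m=4; fix_nat:m'=3` (BOTH dimensions frozen: a
box-rational representation on `(0,1)⁴` against one on `(0,1)³`). Verdict of the attempt seat: **open** —
this file is the exact-strength certificate, not a proof of the variant:

* `stub_boxRigidity_var2268_iff_boxVanishing_four`: V2268 ⟺ **BoxVanishing(4)** — every box-rational
  representation on `(0,1)⁴` of value `0` is a relation (⇒: compare with the zero representation on the
  `3`-box, which is box-rational of value `0` and itself a relation; ⇐: pad the `3`-box side to the `4`-box
  by a unit interval, `pad_le`, and subtract on the common box, `sub_same`, both tree);
* `stub_boxRigidity_var2268_iff_var2265`: hence V2268 is LITERALLY EQUIVALENT to the sibling variant V2265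
  (`fix_nat:m=4; fix_nat:m'=2`, file `…Variants2265`, also ⟺ BoxVanishing(4)): once the larger dimension is
  frozen to `4` the smaller one is idle;
* `stub_boxRigidity_var2268_iff_boxRigidityLe_four`: V2268 ⟺ BoxRigidity with BOTH dimensions `≤ 4`, i.e.
  Conjecture 1 of Kontsevich–Zagier for every pair of rational integrands on the boxes `(0,1)^{≤ 4}`;
* `stub_boxRigidity_var2268_of_statement` / `_of_parent`: Summit ⇒ parent leaf ⇒ V2268, so the variant is
  not refutable short of refuting Conjecture 1 for the tree's calculus (no invariant of `KZ.relations`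
  finer than `eval` is known, and `eval` cannot separate two representations with equal values);
* what it contains, unconditionally: the cube fragment V2242 = BoxVanishing(3)
  (`stub_boxRigidity_var2242_of_var2268`; e.g. Euler's `ζ(2,1) = ζ(3)`:
  `[xy/((1 − xy)(1 − xyz))]_{□³} ∼ [1/(1 − xyz)]_{□³}`), the square fragment BoxVanishing(2) (Catalan rung
  of `CatalanSectorTwoFour` without its open hypothesis `Indep_ℚ(1, π², G)`), and the genuinely
  `(4,3)`-shaped pairs `sectorFourThree_of_stub_boxRigidity_var2268`: `[P(xyzw)/(1 − (xyzw)ᴸ)]` on `(0,1)⁴`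
  (values: `ℚ`-combinations of `1` and level-`L` Hurwitz values of WEIGHT FOUR, e.g.
  `β(4) = Σ (−1)ⁿ/(2n+1)⁴ = ∫ dxdydzdw/(1 + x²y²z²w²)`, `ζ(4) = ∫ dxdydzdw/(1 − xyzw)`) against any
  box-rational representation on `(0,1)³` (values `1, ζ(3) = ∫ dxdydz/(1 − xyz)`, `β(3) = π³/32`, `π²log 2`,
  `Li₃` values, …): for every `a b : ℚ` the instance
  "`β(4) = a + bζ(3) ⇒ [1/(1 + x²y²z²w²)]_{□⁴} ∼ [a + b/(1 − xyz)]_{□³}`" is decided today by no theorem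
  (the `ℚ`-independence of `1, ζ(3), β(4)` is open and no chain of moves is known). Inside BoxVanishing(4)
  itself sit TRUE weight-four identities whose chain of moves is not in the tree, e.g. Euler's
  `ζ(3,1) = ζ(4)/4`: `[xyz/((1 − xyz)(1 − xyzw)) − 1/(4(1 − xyzw))]_{□⁴} ∈ relations`. This is the residual goal.
(Contrast: both dimensions `≤ 1` is the theorem `boxRigidity_of_le_one`, by Baker; dimension `2` is the
first open one, and V2268 sits two rungs above it.)
Source: M. Kontsevich, D. Zagier, *Periods* (2001), §1.2 Conjecture 1. Pure proof file, no definitions. -/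

-- `Summit.<Summit>.<Problem>` is the tree's mandated summit-side namespace (CONVENTIONS §2); for this
-- single-conjunct summit the two coincide, so the duplicate is deliberate.
set_option linter.dupNamespace false

noncomputable section

namespace Summit.KontsevichZagierPeriods.KontsevichZagierPeriods.Theorems

open MeasureTheory Set
open Literature.NumberTheory.Transcendental Literature.NumberTheory.Transcendental.KZ
open Summit.KontsevichZagierPeriods.KontsevichZagierPeriods.Theses.HurwitzMicroSectors
open Summit.KontsevichZagierPeriods.HurwitzMicroSectors.NormalFormPrinciple.PiBox
open Summit.KontsevichZagierPeriods.HurwitzMicroSectors.NormalFormPrinciple.PiBox.stub_boxCombineAux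
  (pad_le sub_same)

/-! ## V2268 is BoxVanishing in dimension 4 -/

/-- **V2268 ⇒ BoxVanishing(4)**: compare a box-rational `N : IntegralRep 4` of value `0` with the zero
representation on the open unit CUBE `(0,1)³` (box-rational, value `0`, itself a relation).
[cite: KontsevichZagier2001, §1.2 Conjecture 1] -/
theorem boxVanishing_four_of_stub_boxRigidity_var2268
    (h : ∀ (N : IntegralRep 4) (N' : IntegralRep 3), N.domain = {x | ∀ i, x i ∈ Set.Ioo (0:ℝ) 1} → N.IsRational → N'.domain = {x | ∀ i, x i ∈ Set.Ioo (0:ℝ) 1} → N'.IsRational → N.value = N'.value → Equivalent N N')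
    (N : IntegralRep 4) (hNd : N.domain = {x | ∀ i, x i ∈ Set.Ioo (0:ℝ) 1}) (hNr : N.IsRational)
    (hv : N.value = 0) : of N ∈ relations := by
  obtain ⟨Z, hZd, hZi⟩ := exists_zeroRep (isSemialgebraic_box 3)
  have hZ : of Z ∈ relations := of_mem_relations_of_eqOn_zero Z (by simp [hZi, EqOn])
  have hZv : Z.value = 0 := by simp [IntegralRep.value, hZi]
  have hZr : Z.IsRational := ⟨0, 1, fun x _ => by simp, fun x _ => by simp [hZi]⟩
  have h' : of N - of Z ∈ relations := h N Z hNd hNr hZd hZr (by rw [hv, hZv])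
  simpa using relations.add_mem h' hZ

/-- **BoxVanishing(4) ⇒ V2268** (instance `m = 4`, `m' = 3` of the padding lemma
`boxRigidityLe_four_of_boxVanishing_four_var2265`: pad the cube side to the `4`-box, subtract on the
common box, the difference has value `0`). [cite: KontsevichZagier2001, §1.2 Conjecture 1] -/
theorem stub_boxRigidity_var2268_of_boxVanishing_four
    (hvan : ∀ N : IntegralRep 4, N.domain = {x | ∀ i, x i ∈ Set.Ioo (0:ℝ) 1} → N.IsRational →
      N.value = 0 → of N ∈ relations) :
    ∀ (N : IntegralRep 4) (N' : IntegralRep 3), N.domain = {x | ∀ i, x i ∈ Set.Ioo (0:ℝ) 1} → N.IsRational → N'.domain = {x | ∀ i, x i ∈ Set.Ioo (0:ℝ) 1} → N'.IsRational → N.value = N'.value → Equivalent N N' :=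
  fun N N' => boxRigidityLe_four_of_boxVanishing_four_var2265 hvan le_rfl (by norm_num) N N'

/-- **V2268 ⟺ BoxVanishing(4)**: the fully frozen instance `(m, m') = (4, 3)` of `stub_boxRigidity` is
exactly the statement that every box-rational representation on `(0,1)⁴` of value `0` is a relation.
[cite: KontsevichZagier2001, §1.2 Conjecture 1] -/
theorem stub_boxRigidity_var2268_iff_boxVanishing_four :
    (∀ (N : IntegralRep 4) (N' : IntegralRep 3), N.domain = {x | ∀ i, x i ∈ Set.Ioo (0:ℝ) 1} → N.IsRational → N'.domain = {x | ∀ i, x i ∈ Set.Ioo (0:ℝ) 1} → N'.IsRational → N.value = N'.value → Equivalent N N') ↔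
    (∀ N : IntegralRep 4, N.domain = {x | ∀ i, x i ∈ Set.Ioo (0:ℝ) 1} → N.IsRational →
      N.value = 0 → of N ∈ relations) :=
  ⟨boxVanishing_four_of_stub_boxRigidity_var2268, stub_boxRigidity_var2268_of_boxVanishing_four⟩

/-- **V2268 ⟺ V2265**: the two fully frozen instances `(4, 3)` and `(4, 2)` of `stub_boxRigidity` are
literally equivalent (both are BoxVanishing(4)); once the larger dimension is frozen the smaller one is
idle. [cite: KontsevichZagier2001, §1.2 Conjecture 1] -/
theorem stub_boxRigidity_var2268_iff_var2265 :
    (∀ (N : IntegralRep 4) (N' : IntegralRep 3), N.domain = {x | ∀ i, x i ∈ Set.Ioo (0:ℝ) 1} → N.IsRational → N'.domain = {x | ∀ i, x i ∈ Set.Ioo (0:ℝ) 1} → N'.IsRational → N.value = N'.value → Equivalent N N') ↔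
    (∀ (N : IntegralRep 4) (N' : IntegralRep 2), N.domain = {x | ∀ i, x i ∈ Set.Ioo (0:ℝ) 1} → N.IsRational → N'.domain = {x | ∀ i, x i ∈ Set.Ioo (0:ℝ) 1} → N'.IsRational → N.value = N'.value → Equivalent N N') :=
  stub_boxRigidity_var2268_iff_boxVanishing_four.trans stub_boxRigidity_var2265_iff_boxVanishing_four.symm

/-- **V2268 ⟺ BoxRigidity with both dimensions `≤ 4`** (the honest strength of the variant: Conjecture 1
for all pairs of rational integrands on the open unit boxes of dimension at most `4`; the frozen `m' = 3`
is idle and the frozen `m = 4` may be relaxed to `m ≤ 4`). [cite: KontsevichZagier2001, §1.2 Conjecture 1] -/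
theorem stub_boxRigidity_var2268_iff_boxRigidityLe_four :
    (∀ (N : IntegralRep 4) (N' : IntegralRep 3), N.domain = {x | ∀ i, x i ∈ Set.Ioo (0:ℝ) 1} → N.IsRational → N'.domain = {x | ∀ i, x i ∈ Set.Ioo (0:ℝ) 1} → N'.IsRational → N.value = N'.value → Equivalent N N') ↔
    (∀ (m m' : ℕ) (N : IntegralRep m) (N' : IntegralRep m'), m ≤ 4 → m' ≤ 4 →
      N.domain = {x | ∀ i, x i ∈ Set.Ioo (0:ℝ) 1} → N.IsRational →
      N'.domain = {x | ∀ i, x i ∈ Set.Ioo (0:ℝ) 1} → N'.IsRational →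
      N.value = N'.value → Equivalent N N') :=
  ⟨fun h _ _ N N' hm hm' => boxRigidityLe_four_of_boxVanishing_four_var2265
      (boxVanishing_four_of_stub_boxRigidity_var2268 h) hm hm' N N',
    fun h N N' => h 4 3 N N' le_rfl (by norm_num)⟩

/-- **V2268 ⇒ BoxVanishing in every dimension `≤ 4`** (pad to the `4`-box, `pad_le`; the value is
kept by soundness). [cite: KontsevichZagier2001, §1.2 Conjecture 1] -/
theorem boxVanishingLe_four_of_stub_boxRigidity_var2268
    (h : ∀ (N : IntegralRep 4) (N' : IntegralRep 3), N.domain = {x | ∀ i, x i ∈ Set.Ioo (0:ℝ) 1} → N.IsRational → N'.domain = {x | ∀ i, x i ∈ Set.Ioo (0:ℝ) 1} → N'.IsRational → N.value = N'.value → Equivalent N N')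
    {m : ℕ} (hm : m ≤ 4) (N : IntegralRep m) (hNd : N.domain = {x | ∀ i, x i ∈ Set.Ioo (0:ℝ) 1})
    (hNr : N.IsRational) (hv : N.value = 0) : of N ∈ relations := by
  obtain ⟨R, hRd, hRr, hR⟩ := pad_le hm N hNd hNr
  have hRv : R.value = 0 := by rw [← Equivalent.value_eq_holds hR, hv]
  have := relations.add_mem hR (boxVanishing_four_of_stub_boxRigidity_var2268 h R hRd hRr hRv)
  rwa [sub_add_cancel] at this

/-- **Parent ⇒ V2268** (the variant is a specialisation of the leaf `stub_boxRigidity`; the converse is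
not claimed — the parent is BoxVanishing in ALL dimensions). [cite: KontsevichZagier2001, §1.2 Conjecture 1] -/
theorem stub_boxRigidity_var2268_of_parent
    (h : ∀ (m m' : ℕ) (N : IntegralRep m) (N' : IntegralRep m'), N.domain = {x | ∀ i, x i ∈ Set.Ioo (0:ℝ) 1} → N.IsRational → N'.domain = {x | ∀ i, x i ∈ Set.Ioo (0:ℝ) 1} → N'.IsRational → N.value = N'.value → Equivalent N N') :
    ∀ (N : IntegralRep 4) (N' : IntegralRep 3), N.domain = {x | ∀ i, x i ∈ Set.Ioo (0:ℝ) 1} → N.IsRational → N'.domain = {x | ∀ i, x i ∈ Set.Ioo (0:ℝ) 1} → N'.IsRational → N.value = N'.value → Equivalent N N' :=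
  h 4 3

/-- **`KontsevichZagierPeriods ⇒ V2268`**: the variant is a special case of Conjecture 1 for the tree's
calculus — a refutation of the variant would refute the Summit. [cite: KontsevichZagier2001, §1.2 Conjecture 1] -/
theorem stub_boxRigidity_var2268_of_statement (h : _root_.KontsevichZagierPeriods) :
    ∀ (N : IntegralRep 4) (N' : IntegralRep 3), N.domain = {x | ∀ i, x i ∈ Set.Ioo (0:ℝ) 1} → N.IsRational → N'.domain = {x | ∀ i, x i ∈ Set.Ioo (0:ℝ) 1} → N'.IsRational → N.value = N'.value → Equivalent N N' :=
  stub_boxRigidity_var2268_of_parent (leaves_of_statement h).1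

/-! ## What the variant contains, unconditionally -/

/-- **V2268 ⇒ V2242** (the cube fragment `m = m' = 3`, i.e. BoxVanishing(3)), one rung down by padding:
e.g. Euler's `ζ(2,1) = ζ(3)` as `[xy/((1 − xy)(1 − xyz))]_{□³} ∼ [1/(1 − xyz)]_{□³}`, and the pair
`[1/(1 − xyz)]` (value `ζ(3)`) versus `[a + b/(1 − xy)]` padded (value `a + bπ²/6`), whose case split is
the open question `ζ(3) ∈ ℚ + ℚπ²`. [cite: KontsevichZagier2001, §1.2 Conjecture 1] -/
theorem stub_boxRigidity_var2242_of_var2268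
    (h : ∀ (N : IntegralRep 4) (N' : IntegralRep 3), N.domain = {x | ∀ i, x i ∈ Set.Ioo (0:ℝ) 1} → N.IsRational → N'.domain = {x | ∀ i, x i ∈ Set.Ioo (0:ℝ) 1} → N'.IsRational → N.value = N'.value → Equivalent N N') :
    ∀ (N : IntegralRep 3) (N' : IntegralRep 3), N.domain = {x | ∀ i, x i ∈ Set.Ioo (0:ℝ) 1} → N.IsRational → N'.domain = {x | ∀ i, x i ∈ Set.Ioo (0:ℝ) 1} → N'.IsRational → N.value = N'.value → Equivalent N N' :=
  fun N N' => boxRigidityLe_four_of_boxVanishing_four_var2265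
    (boxVanishing_four_of_stub_boxRigidity_var2268 h) (by norm_num) (by norm_num) N N'

/-- **V2268 ⇒ the square fragment** (`m = 2, m' ≤ 2`, i.e. BoxVanishing(2) = V2204), two rungs down by
padding; through `sectorTwo_of_stub_boxRigidity_var2204` (file `…Variants2204`) this is Conjecture 1 on
every weight-two Hurwitz sector `P(xy)/(1 − (xy)ᴸ)` of the square with NO linear-independence input.
[cite: KontsevichZagier2001, §1.2 Conjecture 1] -/
theorem boxRigidity_two_le_two_of_stub_boxRigidity_var2268
    (h : ∀ (N : IntegralRep 4) (N' : IntegralRep 3), N.domain = {x | ∀ i, x i ∈ Set.Ioo (0:ℝ) 1} → N.IsRational → N'.domain = {x | ∀ i, x i ∈ Set.Ioo (0:ℝ) 1} → N'.IsRational → N.value = N'.value → Equivalent N N') :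
    ∀ (m' : ℕ) (N : IntegralRep 2) (N' : IntegralRep m'), m' ≤ 2 → N.domain = {x | ∀ i, x i ∈ Set.Ioo (0:ℝ) 1} → N.IsRational → N'.domain = {x | ∀ i, x i ∈ Set.Ioo (0:ℝ) 1} → N'.IsRational → N.value = N'.value → Equivalent N N' :=
  stub_boxRigidity_var2204_of_var2265 (stub_boxRigidity_var2268_iff_var2265.1 h)

/-- **V2268 on its own shape, unconditionally: weight-four Hurwitz sectors of the `4`-box against the
cube.** A representation on `(0,1)⁴` with integrand `P(xyzw)/(1 − (xyzw)ᴸ)` (`L ≠ 0`; values: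
`ℚ`-combinations of `1` and WEIGHT-FOUR level-`L` Hurwitz values, e.g. `ζ(4) = ∫ dxdydzdw/(1 − xyzw)`,
`β(4) = Σ (−1)ⁿ/(2n+1)⁴ = ∫ dxdydzdw/(1 + x²y²z²w²)`) and ANY box-rational representation on the cube
(values: `1`, `ζ(3) = ∫∫∫ dxdydz/(1 − xyz)`, `β(3) = π³/32 = ∫∫∫ dxdydz/(1 + x²y²z²)`, `π² log 2`, `Li₃` and
Clausen values, …) with equal values are KZ-equivalent. Instance: for every `a b : ℚ`,
"`β(4) = a + bζ(3) ⇒ [1/(1 + x²y²z²w²)]_{□⁴} ∼ [a + b/(1 − xyz)]_{□³}`" — decided today by no theorem (the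
`ℚ`-independence of `1, ζ(3), β(4)` is open and no chain of moves is known). This is the residual goal of
the variant in its own `(4, 3)` shape. [cite: KontsevichZagier2001, §1.2 Conjecture 1] -/
theorem sectorFourThree_of_stub_boxRigidity_var2268
    (h : ∀ (N : IntegralRep 4) (N' : IntegralRep 3), N.domain = {x | ∀ i, x i ∈ Set.Ioo (0:ℝ) 1} → N.IsRational → N'.domain = {x | ∀ i, x i ∈ Set.Ioo (0:ℝ) 1} → N'.IsRational → N.value = N'.value → Equivalent N N')
    (L : ℕ) (hL : L ≠ 0) :
    ∀ (r : IntegralRep 4) (r' : IntegralRep 3) (P : Polynomial ℚ),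
      r.domain = {x | ∀ i, x i ∈ Set.Ioo (0:ℝ) 1} →
      EqOn r.integrand
        (fun x => Polynomial.aeval (x 0 * x 1 * x 2 * x 3) P / (1 - (x 0 * x 1 * x 2 * x 3) ^ L)) r.domain →
      r'.domain = {x | ∀ i, x i ∈ Set.Ioo (0:ℝ) 1} → r'.IsRational →
      r.value = r'.value → Equivalent r r' :=
  fun r r' P hr hP hr' hr'r hv => h r r' hr (isRational_of_sectorFour_var2265 L hL r P hr hP) hr' hr'r hv

end Summit.KontsevichZagierPeriods.KontsevichZagierPeriods.Theorems
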